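import Summits.QuantumFields.YangMills.Theses.SandwichVariancePinching

/-!
# Route `SandwichVariancePinching` — the REPAIRED support `SandwichMoments` (stmt-QuantumFields-28261 with `δ < 1`), PROVED:
# under the second-difference sandwich with `(1 − δ)H₀ ≻ 0`, every Gaussian-type moment of `e^{−A}` exists and `∫ e^{−A} > 0`

The filed item `SandwichMoments` (closed interval `δ ≤ 1`) is false at the edge `δ = 1` (`not_SandwichMoments`, sibling file
`…SandwichMomentsRefutation`: `A ≡ 0` on `ℝ¹`).  This file proves the REPAIRED statement C′ — the same body with `δ < 1` — which is
all the route's deciding theorem consumes once the cruxes' `δ₀` is capped below `1`: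

`sandwichMoments_of_lt_one : ∀ δ, 0 ≤ δ → δ < 1 → ∀ n H₀ A, H₀.PosDef → Continuous A →`
`  (∀ x h, (1−δ)·hᵀH₀h ≤ A(x+h) + A(x−h) − 2A(x) ≤ (1+δ)·hᵀH₀h) →`
`  Integrable e^{−A} ∧ 0 < ∫ e^{−A} ∧ ∀ H H' b b', Integrable (q·e^{−A}) ∧ Integrable (q·q'·e^{−A})` (`q = xᵀHx + bᵀx`, `q'` likewise).

THE ARGUMENT (elementary; no convex-analysis library needed).
* §1 Doubling.  `g := A − ((1−δ)/2)·xᵀH₀x` has non-negative second differences, `2g(x) ≤ g(x+h) + g(x−h)`; iterating at `h = x` gives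
  `g(2^k z) ≥ 2^k g(z) − (2^k − 1) g(0)`, and with the minimum of the continuous `g` on the (compact) unit ball this yields a LINEAR
  lower bound `g(x) ≥ −C(1 + ‖x‖)`.
* §2 Quadratic forms.  `xᵀH₀x ≥ λ‖x‖²` with `λ > 0` (minimum on the unit sphere; `H₀ ≻ 0`), and a continuous `k`-homogeneous function is
  `≤ K‖x‖^k` in absolute value (maximum on the unit ball) — applied to `xᵀHx` (`k = 2`) and `bᵀx` (`k = 1`).
* §3 Domination.  Hence `A(x) ≥ −C(1+‖x‖) + κ‖x‖²` (`κ = (1−δ)λ/2 > 0`), and for any weight `|w| ≤ D(1+‖x‖²)²`: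
  `|w e^{−A}| ≤ D·M₀·e^{−κ‖x‖²/4} ≤ D·M₀·∏_i e^{−(κ/(4(n+1)))x_i²}` (sup norm: `Σ x_i² ≤ n‖x‖²`), an integrable product of
  one-dimensional Gaussians (`integrable_exp_neg_mul_sq`, `Integrable.fintype_prod`); positivity of `∫e^{−A}` by `integral_exp_pos`.

HONEST SCOPE.  A routine support (repaired) of a DRAFT sub-line (planner ym-idea-3 g12, LINE 2) onto the open crux
`LogConcaveChart.QuadraticCovarianceComparison`; the cruxes `QuadraticVarianceCeiling` / `QuadraticVarianceFloor`, that crux, rung R2a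
and every summit statement stay open; nothing here bears on the Yang–Mills mass gap.
-/

noncomputable section

namespace Summit.QuantumFields.YangMills.Theorems

namespace SandwichVariancePinching

open MeasureTheory Real Set

variable {n : ℕ}

/-! ## §1 Non-negative second differences ⇒ a linear lower bound -/

/-- DOUBLING: if `2g(x) ≤ g(x+h) + g(x−h)` for all `x, h`, then `2^k·g(z) − (2^k − 1)·g(0) ≤ g(2^k • z)`. [folklore] -/
theorem pow_two_mul_le_of_secondDiff_nonneg {g : (Fin n → ℝ) → ℝ}
    (hg : ∀ x h : Fin n → ℝ, 2 * g x ≤ g (x + h) + g (x - h)) (z : Fin n → ℝ) :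
    ∀ k : ℕ, (2 : ℝ) ^ k * g z - ((2 : ℝ) ^ k - 1) * g 0 ≤ g ((2 : ℝ) ^ k • z)
  | 0 => by simp
  | k + 1 => by
    have ih := pow_two_mul_le_of_secondDiff_nonneg hg z k
    have h2 := hg ((2 : ℝ) ^ k • z) ((2 : ℝ) ^ k • z)
    rw [sub_self, ← add_smul, ← two_mul] at h2
    have hp : (2 : ℝ) ^ (k + 1) = 2 * 2 ^ k := pow_succ' 2 k
    rw [hp]
    linarith

/-- LINEAR LOWER BOUND: a continuous `g : ℝⁿ → ℝ` with non-negative second differences satisfies `−C·(1 + ‖x‖) ≤ g(x)` for some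
`C ≥ 0` (doubling from the unit ball, where `g` attains a minimum). [folklore] -/
theorem exists_linear_lower_of_secondDiff_nonneg {g : (Fin n → ℝ) → ℝ} (hcont : Continuous g)
    (hg : ∀ x h : Fin n → ℝ, 2 * g x ≤ g (x + h) + g (x - h)) :
    ∃ C : ℝ, 0 ≤ C ∧ ∀ x : Fin n → ℝ, -C * (1 + ‖x‖) ≤ g x := by
  obtain ⟨z₀, hz₀, hmin⟩ := (isCompact_closedBall (0 : Fin n → ℝ) 1).exists_isMinOn
    ⟨0, Metric.mem_closedBall_self zero_le_one⟩ hcont.continuousOn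
  set M : ℝ := |g z₀| + |g 0| with hM
  have hM0 : 0 ≤ M := by positivity
  refine ⟨2 * M, by positivity, fun x => ?_⟩
  have hball : ∀ z : Fin n → ℝ, ‖z‖ ≤ 1 → g z₀ ≤ g z := fun z hz =>
    hmin (by simpa [Metric.mem_closedBall, dist_zero_right] using hz)
  rcases le_or_gt ‖x‖ 1 with hx | hx
  · have h1 := hball x hx
    have h2 : -|g z₀| ≤ g z₀ := neg_abs_le _
    nlinarith [norm_nonneg x, abs_nonneg (g 0)]
  · obtain ⟨j, hj1, hj2⟩ := exists_nat_pow_near hx.le one_lt_two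
    set k : ℕ := j + 1 with hk
    have h2k : (0 : ℝ) < 2 ^ k := by positivity
    have h2k_le : (2 : ℝ) ^ k ≤ 2 * ‖x‖ := by rw [hk, pow_succ']; linarith
    set z : Fin n → ℝ := ((2 : ℝ) ^ k)⁻¹ • x with hz
    have hzx : (2 : ℝ) ^ k • z = x := by rw [hz, smul_inv_smul₀ h2k.ne']
    have hz1 : ‖z‖ ≤ 1 := by
      rw [hz, norm_smul, norm_inv, Real.norm_eq_abs, abs_of_pos h2k, inv_mul_le_iff₀ h2k, mul_one]
      exact hj2.le
    have hd := pow_two_mul_le_of_secondDiff_nonneg hg z k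
    rw [hzx] at hd
    have h3 := hball z hz1
    have h4 : -|g z₀| ≤ g z₀ := neg_abs_le _
    have h5 : -|g 0| ≤ g 0 := neg_abs_le _
    have h6 : g 0 ≤ |g 0| := le_abs_self _
    -- `g x ≥ 2^k g z − (2^k − 1) g 0 ≥ −2^k |g z₀| − 2^k |g 0| ≥ −2‖x‖·M`
    have h7 : (2 : ℝ) ^ k * g z ≥ (2 : ℝ) ^ k * (-|g z₀|) :=
      mul_le_mul_of_nonneg_left (h4.trans h3) h2k.le
    have h8 : ((2 : ℝ) ^ k - 1) * g 0 ≤ (2 : ℝ) ^ k * |g 0| := by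
      nlinarith [abs_nonneg (g 0)]
    nlinarith [norm_nonneg x, abs_nonneg (g z₀), abs_nonneg (g 0)]

/-! ## §2 Quadratic and homogeneous forms on `ℝⁿ` (sup norm) -/

/-- `(a•x)ᵀH(a•x) = a²·xᵀHx`. [folklore] -/
theorem dotProduct_mulVec_smul_self (H : Matrix (Fin n) (Fin n) ℝ) (a : ℝ) (x : Fin n → ℝ) :
    (a • x) ⬝ᵥ H.mulVec (a • x) = a ^ 2 * (x ⬝ᵥ H.mulVec x) := by
  rw [Matrix.mulVec_smul, smul_dotProduct, dotProduct_smul, smul_eq_mul, smul_eq_mul]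
  ring

/-- `xᵀHx` is continuous in `x`. [folklore] -/
theorem continuous_dotProduct_mulVec_self (H : Matrix (Fin n) (Fin n) ℝ) :
    Continuous fun x : Fin n → ℝ => x ⬝ᵥ H.mulVec x :=
  continuous_id.dotProduct (continuous_const.matrix_mulVec continuous_id)

/-- A POSITIVE DEFINITE FORM IS COERCIVE: `λ·‖x‖² ≤ xᵀH₀x` for some `λ > 0` (minimum of the form on the compact unit sphere; for
`n = 0` any `λ` works). [folklore] -/
theorem exists_pos_mul_norm_sq_le {H₀ : Matrix (Fin n) (Fin n) ℝ} (hH₀ : H₀.PosDef) :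
    ∃ lam : ℝ, 0 < lam ∧ ∀ x : Fin n → ℝ, lam * ‖x‖ ^ 2 ≤ x ⬝ᵥ H₀.mulVec x := by
  rcases isEmpty_or_nonempty (Fin n) with hn | hn
  · refine ⟨1, one_pos, fun x => ?_⟩
    have hx : x = 0 := Subsingleton.elim _ _
    subst hx
    simp
  · have hS : IsCompact (Metric.sphere (0 : Fin n → ℝ) 1) := isCompact_sphere 0 1
    have hne : (Metric.sphere (0 : Fin n → ℝ) 1).Nonempty := ⟨fun _ => 1, by simp⟩
    obtain ⟨x₀, hx₀, hmin⟩ := hS.exists_isMinOn hne (continuous_dotProduct_mulVec_self H₀).continuousOn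
    have hx₀1 : ‖x₀‖ = 1 := by simpa using hx₀
    have hx₀ne : x₀ ≠ 0 := by
      intro h; rw [h, norm_zero] at hx₀1; exact zero_ne_one hx₀1
    refine ⟨x₀ ⬝ᵥ H₀.mulVec x₀, by simpa using hH₀.dotProduct_mulVec_pos hx₀ne, fun x => ?_⟩
    by_cases hx : x = 0
    · subst hx; simp
    · have hxn : 0 < ‖x‖ := norm_pos_iff.mpr hx
      set u : Fin n → ℝ := ‖x‖⁻¹ • x with hu
      have hu1 : u ∈ Metric.sphere (0 : Fin n → ℝ) 1 := by
        simp [hu, norm_smul, inv_mul_cancel₀ hxn.ne']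
      have hmu : x₀ ⬝ᵥ H₀.mulVec x₀ ≤ u ⬝ᵥ H₀.mulVec u := hmin hu1
      have hxu : x = ‖x‖ • u := by rw [hu, smul_inv_smul₀ hxn.ne']
      have key : x ⬝ᵥ H₀.mulVec x = ‖x‖ ^ 2 * (u ⬝ᵥ H₀.mulVec u) := by
        conv_lhs => rw [hxu]
        exact dotProduct_mulVec_smul_self H₀ ‖x‖ u
      rw [key]
      calc x₀ ⬝ᵥ H₀.mulVec x₀ * ‖x‖ ^ 2 ≤ (u ⬝ᵥ H₀.mulVec u) * ‖x‖ ^ 2 :=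
            mul_le_mul_of_nonneg_right hmu (sq_nonneg _)
        _ = ‖x‖ ^ 2 * (u ⬝ᵥ H₀.mulVec u) := mul_comm _ _

/-- A continuous `k`-HOMOGENEOUS function is bounded by `K·‖x‖^k` (maximum on the compact unit ball). [folklore] -/
theorem exists_abs_le_mul_norm_pow {f : (Fin n → ℝ) → ℝ} (hf : Continuous f) (k : ℕ)
    (hhom : ∀ (a : ℝ) (x : Fin n → ℝ), f (a • x) = a ^ k * f x) :
    ∃ K : ℝ, 0 ≤ K ∧ ∀ x : Fin n → ℝ, |f x| ≤ K * ‖x‖ ^ k := by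
  obtain ⟨K, hK⟩ := (isCompact_closedBall (0 : Fin n → ℝ) 1).exists_bound_of_continuousOn hf.continuousOn
  have hK0 : 0 ≤ K := (norm_nonneg _).trans (hK 0 (Metric.mem_closedBall_self zero_le_one))
  refine ⟨K, hK0, fun x => ?_⟩
  by_cases hx : x = 0
  · subst hx
    rcases Nat.eq_zero_or_pos k with hk | hk
    · subst hk
      simpa using hK 0 (Metric.mem_closedBall_self zero_le_one)
    · have h0 : f 0 = 0 := by
        have := hhom 0 0
        rw [zero_smul, zero_pow hk.ne', zero_mul] at this
        exact this
      rw [h0, abs_zero]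
      positivity
  · have hxn : 0 < ‖x‖ := norm_pos_iff.mpr hx
    set u : Fin n → ℝ := ‖x‖⁻¹ • x with hu
    have hu1 : u ∈ Metric.closedBall (0 : Fin n → ℝ) 1 := by
      simp [hu, norm_smul, inv_mul_cancel₀ hxn.ne']
    have hxu : x = ‖x‖ • u := by rw [hu, smul_inv_smul₀ hxn.ne']
    have hfu : |f u| ≤ K := by simpa [Real.norm_eq_abs] using hK u hu1
    rw [hxu, hhom, abs_mul, abs_pow, abs_norm, norm_smul, norm_norm,
      show ‖u‖ = 1 by simp [hu, norm_smul, inv_mul_cancel₀ hxn.ne'], mul_one]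
    calc ‖x‖ ^ k * |f u| ≤ ‖x‖ ^ k * K := mul_le_mul_of_nonneg_left hfu (by positivity)
      _ = K * ‖x‖ ^ k := mul_comm _ _

/-- `|xᵀHx + bᵀx| ≤ D·(1 + ‖x‖²)` for some `D ≥ 0`. [folklore] -/
theorem exists_abs_quad_le (H : Matrix (Fin n) (Fin n) ℝ) (b : Fin n → ℝ) :
    ∃ D : ℝ, 0 ≤ D ∧ ∀ x : Fin n → ℝ, |x ⬝ᵥ H.mulVec x + b ⬝ᵥ x| ≤ D * (1 + ‖x‖ ^ 2) := by
  obtain ⟨K, hK0, hK⟩ := exists_abs_le_mul_norm_pow (continuous_dotProduct_mulVec_self H) 2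
    (fun a x => dotProduct_mulVec_smul_self H a x)
  obtain ⟨K', hK0', hK'⟩ := exists_abs_le_mul_norm_pow (f := fun x : Fin n → ℝ => b ⬝ᵥ x)
    (continuous_const.dotProduct continuous_id) 1 (fun a x => by simp [dotProduct_smul])
  refine ⟨K + K', by positivity, fun x => ?_⟩
  have h1 := hK x
  have h2 := hK' x
  rw [pow_one] at h2
  have h3 : ‖x‖ ≤ 1 + ‖x‖ ^ 2 := by nlinarith [norm_nonneg x, sq_nonneg (‖x‖ - 1)]
  calc |x ⬝ᵥ H.mulVec x + b ⬝ᵥ x| ≤ |x ⬝ᵥ H.mulVec x| + |b ⬝ᵥ x| := abs_add_le _ _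
    _ ≤ K * ‖x‖ ^ 2 + K' * ‖x‖ := add_le_add h1 h2
    _ ≤ K * (1 + ‖x‖ ^ 2) + K' * (1 + ‖x‖ ^ 2) := by
        gcongr
        · linarith [sq_nonneg ‖x‖]
    _ = (K + K') * (1 + ‖x‖ ^ 2) := by ring

/-! ## §3 Gaussian domination and the repaired item -/

/-- SCALAR BOUND: for `κ > 0` and all real `C`, `r`:
`(1 + r²)²·exp(C(1+r) − κr²) ≤ (1 + 4/κ)²·exp(C + C²/κ)·exp(−(κ/4)·r²)`. [folklore] -/
theorem poly_exp_le {κ : ℝ} (C r : ℝ) (hκ : 0 < κ) :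
    (1 + r ^ 2) ^ 2 * exp (C * (1 + r) - κ * r ^ 2) ≤
      (1 + 4 / κ) ^ 2 * exp (C + C ^ 2 / κ) * exp (-(κ / 4) * r ^ 2) := by
  -- polynomial factor: `1 + r² ≤ (1 + 4/κ)·exp(κr²/4)`
  have h1 : 1 + r ^ 2 ≤ (1 + 4 / κ) * exp (κ * r ^ 2 / 4) := by
    have he : κ * r ^ 2 / 4 + 1 ≤ exp (κ * r ^ 2 / 4) := add_one_le_exp _
    have hid : (1 + 4 / κ) * (κ * r ^ 2 / 4 + 1) = 1 + r ^ 2 + (4 / κ + κ * r ^ 2 / 4) := by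
      field_simp
      ring
    have hpos : 0 ≤ 4 / κ + κ * r ^ 2 / 4 := by positivity
    calc 1 + r ^ 2 ≤ (1 + 4 / κ) * (κ * r ^ 2 / 4 + 1) := by rw [hid]; linarith
      _ ≤ (1 + 4 / κ) * exp (κ * r ^ 2 / 4) := mul_le_mul_of_nonneg_left he (by positivity)
  have h2 : (1 + r ^ 2) ^ 2 ≤ (1 + 4 / κ) ^ 2 * exp (κ * r ^ 2 / 2) := by
    have h := pow_le_pow_left₀ (by positivity) h1 2
    have he : ((1 + 4 / κ) * exp (κ * r ^ 2 / 4)) ^ 2 = (1 + 4 / κ) ^ 2 * exp (κ * r ^ 2 / 2) := by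
      rw [mul_pow, sq (exp _), ← exp_add]
      congr 1
      ring
    rwa [he] at h
  -- linear factor: `C(1+r) − κr² ≤ C + C²/κ − (3κ/4)r²`
  have h3 : C * (1 + r) - κ * r ^ 2 ≤ C + C ^ 2 / κ - 3 * κ / 4 * r ^ 2 := by
    have hsq : 0 ≤ κ / 4 * (r - 2 * C / κ) ^ 2 := by positivity
    have hid : κ / 4 * (r - 2 * C / κ) ^ 2 = κ * r ^ 2 / 4 - C * r + C ^ 2 / κ := by
      field_simp
      ring
    nlinarith
  calc (1 + r ^ 2) ^ 2 * exp (C * (1 + r) - κ * r ^ 2)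
      ≤ ((1 + 4 / κ) ^ 2 * exp (κ * r ^ 2 / 2)) * exp (C + C ^ 2 / κ - 3 * κ / 4 * r ^ 2) :=
        mul_le_mul h2 (exp_le_exp.mpr h3) (exp_pos _).le (by positivity)
    _ = (1 + 4 / κ) ^ 2 * exp (C + C ^ 2 / κ) * exp (-(κ / 4) * r ^ 2) := by
        rw [mul_assoc, mul_assoc, ← exp_add, ← exp_add]
        congr 2
        ring

/-- GAUSSIAN DOMINATION ON `ℝⁿ` (sup norm, Lebesgue measure): if `A` is continuous with `−C(1+‖x‖) + κ‖x‖² ≤ A(x)` (`κ > 0`,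
`C ≥ 0`) and `w` is continuous with `|w(x)| ≤ D(1 + ‖x‖²)²`, then `w·e^{−A}` is integrable — dominated by a constant times the
product Gaussian `∏_i exp(−(κ/(4(n+1)))·x_i²)`. [folklore] -/
theorem integrable_mul_exp_neg_of_lower_bound {A w : (Fin n → ℝ) → ℝ} (hA : Continuous A) (hw : Continuous w)
    {C κ D : ℝ} (hκ : 0 < κ)
    (hlb : ∀ x, -C * (1 + ‖x‖) + κ * ‖x‖ ^ 2 ≤ A x) (hwb : ∀ x, |w x| ≤ D * (1 + ‖x‖ ^ 2) ^ 2) :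
    Integrable (fun x => w x * exp (-A x)) := by
  set b : ℝ := κ / (4 * ((n : ℝ) + 1)) with hb
  have hb0 : 0 < b := by positivity
  set M₀ : ℝ := (1 + 4 / κ) ^ 2 * exp (C + C ^ 2 / κ) with hM₀
  have hD : 0 ≤ D := by
    have := (abs_nonneg _).trans (hwb 0)
    simpa using this
  -- the dominating product Gaussian
  have hG : Integrable (fun x : Fin n → ℝ => D * M₀ * ∏ i, exp (-b * (x i) ^ 2)) := by
    have h := (Integrable.fintype_prod (f := fun (_ : Fin n) (t : ℝ) => exp (-b * t ^ 2))
      (μ := fun _ => volume) (fun _ => integrable_exp_neg_mul_sq hb0)).const_mul (D * M₀)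
    rw [← volume_pi] at h
    exact h
  refine hG.mono' ((hw.mul (continuous_exp.comp hA.neg)).aestronglyMeasurable) (ae_of_all _ fun x => ?_)
  -- pointwise: `|w e^{−A}| ≤ D (1+‖x‖²)² e^{C(1+‖x‖) − κ‖x‖²} ≤ D M₀ e^{−κ‖x‖²/4} ≤ D M₀ ∏ e^{−b x_i²}`
  have hr := norm_nonneg x
  have h1 : ‖w x * exp (-A x)‖ ≤ D * (1 + ‖x‖ ^ 2) ^ 2 * exp (C * (1 + ‖x‖) - κ * ‖x‖ ^ 2) := by
    rw [norm_mul, Real.norm_eq_abs, Real.norm_eq_abs, abs_of_pos (exp_pos _)]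
    refine mul_le_mul (hwb x) (exp_le_exp.mpr (by linarith [hlb x])) (exp_pos _).le (by positivity)
  have h2 : D * (1 + ‖x‖ ^ 2) ^ 2 * exp (C * (1 + ‖x‖) - κ * ‖x‖ ^ 2) ≤ D * (M₀ * exp (-(κ / 4) * ‖x‖ ^ 2)) := by
    rw [mul_assoc]
    exact mul_le_mul_of_nonneg_left (poly_exp_le C ‖x‖ hκ) hD
  have h3 : exp (-(κ / 4) * ‖x‖ ^ 2) ≤ ∏ i, exp (-b * (x i) ^ 2) := by
    rw [← exp_sum, exp_le_exp, ← Finset.mul_sum]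
    have hsum : ∑ i : Fin n, (x i) ^ 2 ≤ ((n : ℝ) + 1) * ‖x‖ ^ 2 := by
      calc ∑ i : Fin n, (x i) ^ 2 ≤ ∑ _i : Fin n, ‖x‖ ^ 2 := Finset.sum_le_sum fun i _ => by
              have hi : |x i| ≤ ‖x‖ := by simpa [Real.norm_eq_abs] using norm_le_pi_norm x i
              rw [← sq_abs]
              exact pow_le_pow_left₀ (abs_nonneg _) hi 2
        _ = (n : ℝ) * ‖x‖ ^ 2 := by simp
        _ ≤ ((n : ℝ) + 1) * ‖x‖ ^ 2 := by nlinarith [sq_nonneg ‖x‖]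
    have hb' : b * ∑ i : Fin n, (x i) ^ 2 ≤ κ / 4 * ‖x‖ ^ 2 := by
      calc b * ∑ i : Fin n, (x i) ^ 2 ≤ b * (((n : ℝ) + 1) * ‖x‖ ^ 2) := mul_le_mul_of_nonneg_left hsum hb0.le
        _ = κ / 4 * ‖x‖ ^ 2 := by rw [hb]; field_simp
    linarith
  calc ‖w x * exp (-A x)‖ ≤ D * (1 + ‖x‖ ^ 2) ^ 2 * exp (C * (1 + ‖x‖) - κ * ‖x‖ ^ 2) := h1
    _ ≤ D * (M₀ * exp (-(κ / 4) * ‖x‖ ^ 2)) := h2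
    _ ≤ D * (M₀ * ∏ i, exp (-b * (x i) ^ 2)) := by gcongr
    _ = D * M₀ * ∏ i, exp (-b * (x i) ^ 2) := by ring

/-- **THE REPAIRED SUPPORT `SandwichMoments` with `δ < 1`** (C′ of the refutation `not_SandwichMoments`): for `0 ≤ δ < 1`, `H₀ ≻ 0`,
`A` continuous with second differences pinched between `(1−δ)hᵀH₀h` and `(1+δ)hᵀH₀h`: `e^{−A}` is integrable, `∫ e^{−A} > 0`, and
`q·e^{−A}`, `q·q'·e^{−A}` are integrable for all quadratic-plus-linear `q, q'`.  Only the LOWER pinching and `δ < 1` are used.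
[folklore] -/
theorem sandwichMoments_of_lt_one : ∀ (δ : ℝ), 0 ≤ δ → δ < 1 → ∀ (n : ℕ) (H₀ : Matrix (Fin n) (Fin n) ℝ)
    (A : (Fin n → ℝ) → ℝ), H₀.PosDef → Continuous A →
    (∀ x h : Fin n → ℝ, (1 - δ) * (h ⬝ᵥ H₀.mulVec h) ≤ A (x + h) + A (x - h) - 2 * A x ∧
      A (x + h) + A (x - h) - 2 * A x ≤ (1 + δ) * (h ⬝ᵥ H₀.mulVec h)) →
    Integrable (fun x => Real.exp (-A x)) ∧ 0 < ∫ x, Real.exp (-A x) ∧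
      ∀ (H H' : Matrix (Fin n) (Fin n) ℝ) (b b' : Fin n → ℝ),
        Integrable (fun x => (x ⬝ᵥ H.mulVec x + b ⬝ᵥ x) * Real.exp (-A x)) ∧
        Integrable (fun x => (x ⬝ᵥ H.mulVec x + b ⬝ᵥ x) * (x ⬝ᵥ H'.mulVec x + b' ⬝ᵥ x) * Real.exp (-A x)) := by
  intro δ _ hδ1 n H₀ A hH₀ hA hsw
  -- §1: `g = A − ((1−δ)/2)·xᵀH₀x` has non-negative second differences, hence a linear lower bound
  set c : ℝ := (1 - δ) / 2 with hc
  have hc0 : 0 < c := by rw [hc]; linarith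
  set g : (Fin n → ℝ) → ℝ := fun x => A x - c * (x ⬝ᵥ H₀.mulVec x) with hgdef
  have hgcont : Continuous g := hA.sub (continuous_const.mul (continuous_dotProduct_mulVec_self H₀))
  have hg2 : ∀ x h : Fin n → ℝ, 2 * g x ≤ g (x + h) + g (x - h) := by
    intro x h
    have h1 := (hsw x h).1
    have hq : (x + h) ⬝ᵥ H₀.mulVec (x + h) + (x - h) ⬝ᵥ H₀.mulVec (x - h) =
        2 * (x ⬝ᵥ H₀.mulVec x) + 2 * (h ⬝ᵥ H₀.mulVec h) := by
      simp only [Matrix.mulVec_add, Matrix.mulVec_sub, add_dotProduct, sub_dotProduct, dotProduct_add, dotProduct_sub]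
      ring
    have hq' : c * ((x + h) ⬝ᵥ H₀.mulVec (x + h)) + c * ((x - h) ⬝ᵥ H₀.mulVec (x - h)) =
        2 * (c * (x ⬝ᵥ H₀.mulVec x)) + 2 * (c * (h ⬝ᵥ H₀.mulVec h)) := by
      rw [← mul_add, hq]
      ring
    have hcq : c * (h ⬝ᵥ H₀.mulVec h) = (1 - δ) / 2 * (h ⬝ᵥ H₀.mulVec h) := by rw [hc]
    simp only [hgdef]
    linarith
  obtain ⟨C, hC0, hClb⟩ := exists_linear_lower_of_secondDiff_nonneg hgcont hg2
  -- §2: coercivity of `H₀`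
  obtain ⟨lam, hlam, hlamle⟩ := exists_pos_mul_norm_sq_le hH₀
  have hκ : 0 < c * lam := mul_pos hc0 hlam
  have hlb : ∀ x : Fin n → ℝ, -C * (1 + ‖x‖) + c * lam * ‖x‖ ^ 2 ≤ A x := by
    intro x
    have h1 := hClb x
    have h2 := mul_le_mul_of_nonneg_left (hlamle x) hc0.le
    have h3 : A x = g x + c * (x ⬝ᵥ H₀.mulVec x) := by simp [hgdef]
    rw [h3]
    linarith
  -- §3: the four conclusions
  have hq : ∀ (H : Matrix (Fin n) (Fin n) ℝ) (b : Fin n → ℝ),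
      Continuous fun x : Fin n → ℝ => x ⬝ᵥ H.mulVec x + b ⬝ᵥ x := fun H b =>
    (continuous_dotProduct_mulVec_self H).add (continuous_const.dotProduct continuous_id)
  have hone : Integrable (fun x => Real.exp (-A x)) := by
    have h := integrable_mul_exp_neg_of_lower_bound (w := fun _ => (1 : ℝ)) hA continuous_const hκ hlb
      (D := 1) (fun x => by
        rw [abs_one, one_mul]
        nlinarith [sq_nonneg ‖x‖, sq_nonneg (‖x‖ ^ 2)])
    simpa using h
  refine ⟨hone, integral_exp_pos hone, fun H H' b b' => ⟨?_, ?_⟩⟩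
  · obtain ⟨D, hD0, hD⟩ := exists_abs_quad_le H b
    refine integrable_mul_exp_neg_of_lower_bound hA (hq H b) hκ hlb (D := D) fun x => ?_
    calc |x ⬝ᵥ H.mulVec x + b ⬝ᵥ x| ≤ D * (1 + ‖x‖ ^ 2) := hD x
      _ ≤ D * (1 + ‖x‖ ^ 2) ^ 2 := by
          refine mul_le_mul_of_nonneg_left ?_ hD0
          nlinarith [sq_nonneg ‖x‖, sq_nonneg (‖x‖ ^ 2)]
  · obtain ⟨D, hD0, hD⟩ := exists_abs_quad_le H b
    obtain ⟨D', hD0', hD'⟩ := exists_abs_quad_le H' b'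
    refine integrable_mul_exp_neg_of_lower_bound hA ((hq H b).mul (hq H' b')) hκ hlb (D := D * D') fun x => ?_
    rw [abs_mul]
    calc |x ⬝ᵥ H.mulVec x + b ⬝ᵥ x| * |x ⬝ᵥ H'.mulVec x + b' ⬝ᵥ x|
        ≤ (D * (1 + ‖x‖ ^ 2)) * (D' * (1 + ‖x‖ ^ 2)) :=
          mul_le_mul (hD x) (hD' x) (abs_nonneg _) (by positivity)
      _ = D * D' * (1 + ‖x‖ ^ 2) ^ 2 := by ring

end SandwichVariancePinching

end Summit.QuantumFields.YangMills.Theorems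

end
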